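import Mathlib

/-!
# Sketch — crux `SymplecticBettiParity` (stmt-SmoothPoincare4-16622), crux-ideate round 1, ideator 1

First lemmas of the two idea cards, at fibre level, over Mathlib's quaternions `ℍ` — the model
`V = ℍ`, `SO(4) = {x ↦ p x q̄}`, `J = i·` of the tree's `Literature.Geometry.GaugeTheory`
(`SpinorAlgebraFour`, `AlmostComplexSpincFour.modelJ`, `SelfDualComplexSymbol.sdSymbol` /
`toQuat_mul_star`: the rolled-up principal symbol of `d* ⊕ d⁺ : Ω¹ → Ω⁰ ⊕ Ω²₊` at `ξ` is
`α ↦ ξ ᾱ`, real part `⟨ξ, α⟩`, imaginary part `-(ξ ∧ α)⁺`).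
-/

open Quaternion
open scoped Quaternion

namespace Summit.SmoothPoincare4.SmoothPoincare4.Cruxes.SymplecticBettiParity.Sketch

/-- The complex unit `i ∈ ℂ ⊂ ℍ`; `J = (qI * ·)` is the model complex structure on `Λ¹ ≅ ℍ`. -/
noncomputable def qI : ℍ := ((Complex.I : ℂ) : ℍ)

theorem qI_mul_qI : qI * qI = -1 := by
  unfold qI
  rw [← coeComplex_mul, Complex.I_mul_I]
  ext <;> simp

theorem star_qI : star qI = -qI := by
  unfold qI; ext <;> simp

/-! ## Card A (`j-averaged-hodge-index`): the symbol of `d* ⊕ d⁺` is `J`-linear for a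
`ξ`-INDEPENDENT complex structure on the target -/

/-- **First lemma of card A (fibre level).** In the quaternion model the principal symbol
`σ_ξ(α) = ξ ᾱ` of `d* ⊕ d⁺` intertwines LEFT multiplication by `i` on the source `Λ¹ = ℍ`
with RIGHT multiplication by `ī = -i` on the target `Λ⁰ ⊕ Λ²₊ = Re ℍ ⊕ Im ℍ`; the target structure
`𝒥₂ := (· * star qI)` does not depend on `ξ`. -/
theorem symbol_modelJ (ξ α : ℍ) : ξ * star (qI * α) = (ξ * star α) * star qI := by
  rw [star_mul, mul_assoc]

/-- `𝒥₂ = (· * star qI)` is a complex structure on the target. -/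
theorem targetJ_sq (q : ℍ) : (q * star qI) * star qI = -q := by
  rw [mul_assoc, ← star_mul, qI_mul_qI, star_neg, star_one, mul_neg_one]

/-- `𝒥₂` pairs the scalars `Λ⁰ = ℝ·1` with the line `ℝ·i ⊂ Im ℍ = Λ²₊` spanned by the Kähler
form `ω = e⁰∧e¹ + e²∧e³` of `J = i·` (first self-dual component), and rotates the plane
`span(j, k) = Λ^{2,0}_ℝ`: `𝒥₂ 1 = -i`. -/
theorem targetJ_one : (1 : ℍ) * star qI = -qI := by
  rw [one_mul, star_qI]

/-- **Averaging (Atiyah's trick), finite-dimensional shape.** If a real-linear `D : X → Y`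
has "symbol" intertwining complex structures `J₁, J₂` only up to an error `K`
(`D ∘ J₁ = J₂ ∘ D + K`), then `D_J := ½ (D - J₂ ∘ D ∘ J₁)` is exactly `(J₁, J₂)`-linear.
(On the manifold `K` is of order zero, so `D_J` has the same principal symbol as `D`.) -/
theorem averaged_linear {X Y : Type*} [AddCommGroup X] [Module ℝ X] [AddCommGroup Y] [Module ℝ Y]
    (J₁ : X →ₗ[ℝ] X) (J₂ : Y →ₗ[ℝ] Y) (h₁ : J₁ ∘ₗ J₁ = -LinearMap.id) (h₂ : J₂ ∘ₗ J₂ = -LinearMap.id)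
    (D : X →ₗ[ℝ] Y) :
    let DJ : X →ₗ[ℝ] Y := (1/2 : ℝ) • (D - J₂ ∘ₗ D ∘ₗ J₁)
    DJ ∘ₗ J₁ = J₂ ∘ₗ DJ := by
  intro DJ
  have e₁ : ∀ x, J₁ (J₁ x) = -x := fun x ↦ by
    simpa using LinearMap.congr_fun h₁ x
  have e₂ : ∀ y, J₂ (J₂ y) = -y := fun y ↦ by
    simpa using LinearMap.congr_fun h₂ y
  ext x
  simp only [DJ, LinearMap.comp_apply, LinearMap.smul_apply, LinearMap.sub_apply, e₁, e₂,
    map_neg, map_smul, map_sub]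
  module

/-- **Parity from complex-linearity, finite-dimensional shape** (the Fredholm statement has the
same proof on `ker` and `coker`): a real-linear map between finite-dimensional spaces commuting
with complex structures has even `dim ker - dim coker`, i.e. `dim X - dim Y` is even and so is
`dim ker D - dim coker D = dim X - dim Y`.  Stated, not proved here. -/
theorem even_finrank_sub_of_complexStructures {X Y : Type*} [AddCommGroup X] [Module ℝ X]
    [FiniteDimensional ℝ X] [AddCommGroup Y] [Module ℝ Y] [FiniteDimensional ℝ Y]
    (J₁ : X →ₗ[ℝ] X) (J₂ : Y →ₗ[ℝ] Y) (h₁ : J₁ ∘ₗ J₁ = -LinearMap.id) (h₂ : J₂ ∘ₗ J₂ = -LinearMap.id)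
    (D : X →ₗ[ℝ] Y) (hD : D ∘ₗ J₁ = J₂ ∘ₗ D) :
    Even ((Module.finrank ℝ (LinearMap.ker D) : ℤ) - Module.finrank ℝ (Y ⧸ LinearMap.range D)) := by
  sorry

/-! ## Card B (`intertwiner-line-twist`): two orientation-compatible complex structures on one
oriented Euclidean `4`-plane differ by a complex LINE of intertwiners -/

/-- The intertwiner space between the left complex structures `u·` and `u'·` (`u² = u'² = -1`):
`N(u, u') = {a ∈ ℍ | a u = u' a}` — a real-linear condition. -/
noncomputable def intertwiner (u u' : ℍ) : Submodule ℝ ℍ :=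
  LinearMap.ker (LinearMap.mulRight ℝ u - LinearMap.mulLeft ℝ u')

theorem mem_intertwiner {u u' a : ℍ} : a ∈ intertwiner u u' ↔ a * u = u' * a := by
  simp [intertwiner, sub_eq_zero]

/-- The unit quaternions `i, j, k` (typed as `ℍ`). -/
noncomputable def qi : ℍ := ⟨0, 1, 0, 0⟩
/-- see `qi` -/
noncomputable def qj : ℍ := ⟨0, 0, 1, 0⟩
/-- see `qi` -/
noncomputable def qk : ℍ := ⟨0, 0, 0, 1⟩

/-- **First lemma of card B (fibre level), worked instance `u = i`, `u' = j`:** `1 + k`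
intertwines (`(1 + k) i = i + j = j (1 + k)`), and it is invertible (`|1 + k|² = 2`). -/
theorem one_add_k_mem_intertwiner : 1 + qk ∈ intertwiner qi qj := by
  apply mem_intertwiner.mpr
  ext <;> simp [qi, qj, qk]

/-- **Cheapest falsifier of card B, kernel-checked:** for `u = i`, `u' = j` the intertwiners are
EXACTLY `a₀ (1 + k) + a₁ (i + j)` — a real `2`-plane (`re = imK`, `imI = imJ`). -/
theorem mem_intertwiner_i_j_iff (a : ℍ) :
    a ∈ intertwiner qi qj ↔ a.re = a.imK ∧ a.imI = a.imJ := by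
  rw [mem_intertwiner]
  constructor
  · intro h
    have h1 := congr_arg QuaternionAlgebra.re h
    have h2 := congr_arg QuaternionAlgebra.imI h
    simp [qi, qj] at h1 h2
    exact ⟨by linarith, by linarith⟩
  · rintro ⟨h1, h2⟩
    ext <;> simp [qi, qj] <;> linarith

/-- **First lemma of card B (fibre level), general shape:** for unit imaginary `u, u'`
(`u² = u'² = -1`) the intertwiner space is a real `2`-plane all of whose non-zero elements are
invertible, stable under `a ↦ u' a` (so a complex line for the structure `u'·`).  Over an
embedded surface `S ⊂ N` this is the fibre of the intertwiner line bundle `𝒩` with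
`(T_S N, j_T ⊕ j_ν) ≅ (T_S N, J) ⊗ 𝒩`, whence `c₁(T_S N, J) ≡ c₁(TS) + c₁(ν_S) (mod 2)`.
Stated, not proved here. -/
theorem finrank_intertwiner (u u' : ℍ) (hu : u * u = -1) (hu' : u' * u' = -1) :
    Module.finrank ℝ (intertwiner u u') = 2 ∧
      (∀ a ∈ intertwiner u u', a ≠ 0 → IsUnit a) ∧
      ∀ a ∈ intertwiner u u', u' * a ∈ intertwiner u u' := by
  refine ⟨?_, ?_, ?_⟩
  · sorry
  · intro a _ ha
    exact isUnit_iff_ne_zero.mpr ha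
  · intro a ha
    rw [mem_intertwiner] at ha ⊢
    rw [mul_assoc, ha]

end Summit.SmoothPoincare4.SmoothPoincare4.Cruxes.SymplecticBettiParity.Sketch
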